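import Literature.MathematicalPhysics.QuantumFieldTheory.Balaban1983to89.T4Hk163StripRate

/-!
# `BalabanUV.Beta.GAN24.Hk163CornerTower` — binder row G-an2-4 ∕ (CONV-C): THE VECTOR MINIMISER `H_k` OF B5 (1.63) AT `U = 1` IN (CONV-C)'s
# TWO-CLAUSE SHAPE, BLOCK-CORNER (INJECTION) CURRENCY, RATE `θ = L⁻¹` — A PACKAGING, BY NAME, of the NE2 lane's `T4Hk163StripRate` and b05's
# `B5Hk163Decay` (NO new estimate is proved here)

NOT IN PRINT; OUR PROOF ATTEMPT (prover part P3 of row G-an2-4, fibre∕strip lineage, gen 23; CRUX TEAM (2), ruling «YM REDIRECT TOWARDS THE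
SUMMIT», 2026-08-21).  HONEST DEPENDENCY (cell records, verbatim): «continuum YM on T⁴ ⇐ BetaPertH ∧ nine spine estimates (0/9 proved);
BetaPertH ⇐ (D1) ∧ (D4) ∧ CAP+tail; G-an2-4 gates asym, D1 and NE2/3/4.»  HONEST FRAMING (cell contract, verbatim): «discharging `BetaPertH`
makes Bałaban's UV stability UNCONDITIONAL — a real constructive-QFT result; it is NOT the continuum limit and NOT the Clay problem.»  ABSOLUTE
RULE: nothing printed is a hypothesis.  PURPOSE (records hygiene for the crux census and the SUMMIT-MAP): the row's ledger reading of (CONV-C)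
lists `H` among the constituents; the tree already HOLDS, for the VECTOR minimiser `H_k` of B5 (1.63) at `U = 1` (multipliers `B5Hk163Decay.G163 n μ λ a`,
fine offset `a`, components `μ, λ`), the `k`-uniform decay (`latticeKernel_G163_decay`) and the `η¹`-rate at the same physical fine offset
(`T4Hk163StripRate.latticeKernel_G163_rate`, t4-ne2-p2 gen 5).  This file states the two facts ONCE in the literal two-clause shape of the cell's
(CONV-C) (`GAN24.DirichletExhaustion.ConvC`: uniform decay + geometric Cauchy) for the block-CORNER reading (fine offset `0` at every level —
the same physical point `y`), so that a census line can cite ONE declaration: `hk163_corner_two_clauses`.  [folklore]; 0 def, 0 sorry.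

HONEST: θ = L⁻¹ is what the injection currency gives (the half-spacing phases of (1.63) are first order — R1 v2 note (H) of `beta/ROUTES-GAN24.md`);
the sharp θ = L⁻² needs a sub-averaged∕smeared fine leg (done for the SCALAR minimiser in `SubAveragingMinimiser*`, NOT for the vector one).
NOT composites, NOT `U ≠ 1`.  NEVER «G-an2-4 closed»; NOT D1, NOT BetaPertH, NOT continuum, NOT Clay.  Provenance:
prover-b2b-balaban-gan24-p3-g23-0 (unit `b2b-balaban-gan24-p3`, gen 23), 2026-08-21.
-/

noncomputable section

namespace Summit.QuantumFields.BalabanUV.Beta.GAN24.Hk163CornerTower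

open Literature.MathematicalPhysics.QuantumFieldTheory.Balaban1983to89
open Literature.MathematicalPhysics.QuantumFieldTheory.Balaban1983to89.B4ContourShift
open Literature.MathematicalPhysics.QuantumFieldTheory.Balaban1983to89.B5Hk163Strip (kappa163 kappa163_pos)
open Literature.MathematicalPhysics.QuantumFieldTheory.Balaban1983to89.B5Hk163Decay
open Literature.MathematicalPhysics.QuantumFieldTheory.Balaban1983to89.T4Hk163StripRate

variable {d : ℕ}

/-- [folklore] **THE VECTOR `H_k` OF B5 (1.63) AT `U = 1`: (CONV-C)'s TWO CLAUSES IN THE BLOCK-CORNER CURRENCY, RATE `θ = L⁻¹`** (packaging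
by name of `B5Hk163Decay.latticeKernel_G163_decay` and `T4Hk163StripRate.latticeKernel_G163_rate`).  With
`K_j(μ,λ;x) := latticeKernel (G163 (L^j) μ λ 0) x` — the `(μ,λ)` entry of the kernel of `H_j` read at the block corner `y` of the fine leg,
`x = y − y′ ∈ ℤ^{d+1}` — for every `L ≥ 1` there are `κ > 0`, `C ≥ 0` (functions of `d` alone) such that for every `j`, `μ`, `λ`, `x`:
 (i) `‖K_j(μ,λ;x)‖ ≤ C·e^{−κ|x|_∞}`;  (ii) `‖K_{j+1}(μ,λ;x) − K_j(μ,λ;x)‖ ≤ C·(L⁻¹)^j·e^{−κ|x|_∞}`. -/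
theorem hk163_corner_two_clauses (d : ℕ) (L : ℕ) [NeZero L] :
    ∃ κ C : ℝ, 0 < κ ∧ 0 ≤ C ∧
      (∀ (j : ℕ) (μ lam : Fin (d + 1)) (x : Fin (d + 1) → ℤ),
        ‖latticeKernel (fun p : Fin (d + 1) → ℂ =>
            @G163 (d + 1) (L ^ j) ⟨pow_ne_zero j (NeZero.ne L)⟩ μ lam (fun _ => ⟨0, pow_pos (Nat.pos_of_ne_zero (NeZero.ne L)) j⟩) p) x‖
          ≤ C * Real.exp (-(κ * supNorm x))) ∧
      (∀ (j : ℕ) (μ lam : Fin (d + 1)) (x : Fin (d + 1) → ℤ),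
        ‖latticeKernel (fun p : Fin (d + 1) → ℂ =>
              @G163 (d + 1) (L ^ (j + 1)) ⟨pow_ne_zero (j + 1) (NeZero.ne L)⟩ μ lam
                (fun _ => ⟨0, pow_pos (Nat.pos_of_ne_zero (NeZero.ne L)) (j + 1)⟩) p) x
          - latticeKernel (fun p : Fin (d + 1) → ℂ =>
              @G163 (d + 1) (L ^ j) ⟨pow_ne_zero j (NeZero.ne L)⟩ μ lam
                (fun _ => ⟨0, pow_pos (Nat.pos_of_ne_zero (NeZero.ne L)) j⟩) p) x‖
          ≤ C * ((L : ℝ)⁻¹) ^ j * Real.exp (-(κ * supNorm x))) := by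
  refine ⟨kappa163 (d + 1), max (MG163 (d + 1)) (CGe (d + 1)), kappa163_pos _, le_max_of_le_left (MG163_nonneg _), ?_, ?_⟩
  · intro j μ lam x
    haveI : NeZero (L ^ j) := ⟨pow_ne_zero j (NeZero.ne L)⟩
    refine (latticeKernel_G163_decay (L ^ j) μ lam _ x).trans ?_
    exact mul_le_mul_of_nonneg_right (le_max_left _ _) (Real.exp_pos _).le
  · intro j μ lam x
    haveI : NeZero (L ^ j) := ⟨pow_ne_zero j (NeZero.ne L)⟩
    haveI : NeZero (L ^ (j + 1)) := ⟨pow_ne_zero (j + 1) (NeZero.ne L)⟩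
    have h := latticeKernel_G163_rate_king (d := d) L j 1 μ lam
      (fun _ => ⟨0, pow_pos (Nat.pos_of_ne_zero (NeZero.ne L)) j⟩)
      (fun _ => ⟨0, pow_pos (Nat.pos_of_ne_zero (NeZero.ne L)) (j + 1)⟩) (fun _ => by simp) x
    refine h.trans ?_
    rw [div_eq_mul_inv, ← inv_pow]
    have hexp : 0 ≤ Real.exp (-(kappa163 (d + 1) * supNorm x)) := (Real.exp_pos _).le
    have hLp : 0 ≤ ((L : ℝ)⁻¹) ^ j := by positivity
    gcongr
    exact le_max_right _ _

end Summit.QuantumFields.BalabanUV.Beta.GAN24.Hk163CornerTower
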